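import Mathlib
import Summits.Ventures.PercRepro2.CoinKSureAD

/-!
# The ONE-MARKER BOUND of the pure chain: the pivotal mass times the downward world shift of a
marker is at most the ideal mass times the excess of the world-1 mean over the ideal mean
(blind cell PercRepro2, night-2 g22; proofs/NIGHT2-DARC.md §62.6)

Pure chain data on `U.powerset`: world-0 law `ν·c`, world-1 `R`-law `ν·d` on the entered clusters
(those meeting `ent'`) and `ν·c` on the entry-free IDEAL `I`, world-1 gate `ν·d'` on the entered
clusters; an increasing marker `y`.  Write `m = ∑_I ν c` (the ideal mass, common to the three
laws), `M = ∑_D ν c`, `r = ∑_D ν d`, `g = ∑_D ν d'` (the entered masses of the three laws),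
`yI = ∑_I ν c y`, `yM = ∑_D ν c y`, `yr = ∑_D ν d y` (the marker moments).  The world-0 mean is
`q₀ = (yI + yM)/(m + M)`, the world-1 mean `q₁ = (yI + yr)/(m + r)`, the ideal mean `qI = yI/m`,
and the pivotal mass `P₀ = r − g`.

**(OM)** `P₀ · (q₀ − q₁) ≤ m · (q₁ − qI)`, in cleared form
`(r − g) · m · (yI (r − M) + yM (m + r) − yr (m + M)) ≤ m (m + M) (yr m − yI r)`
(`one_marker_bound`).  Proof: the left side is affine in `g ∈ [0, r]`; at `g = r` it is `0`, at
`g = 0` the inequality is `q₀ ≤ q_{rD}` (the world-0 mean is below the world-1 mean ON THE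
ENTERED CLUSTERS), which holds because `ν d` is Holley-above `ν c` (`mean_le_tilt`) and the
entered clusters form an up-set for the log-supermodular `ν d` (`tilt_upset_mean`); the right
side is nonnegative because the ideal mean is below the world-1 entered mean
(`ideal_le_entered_R`).  The intermediate «world-0 entered mean ≤ world-1 entered mean» is FALSE
in general (conditioning on the up-set destroys positive association): the proof goes through
the GLOBAL tilt `ν d`.

**Consequence (§62.6, (Q_I))**: in the anti-aligned pattern `p₁ > p₀`, `q₀ > q₁` the ideal-state
term of the clean-state sum of `T(R¹, G¹)` pays the pivotal mass times the product of the world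
shifts: `m (p₁ − pI)(q₁ − qI) ≥ P₀ (p₁ − p₀)(q₀ − q₁)` (`ideal_term_pays`), from (OM) for `y` and
`p₀ ≥ pI` (`ideal_le_global`).
-/

namespace Summit.Ventures.PercRepro2.Coin

open Classical

section OneMarkerAlgebra

variable {R : Type*} [Field R] [LinearOrder R] [IsStrictOrderedRing R]

/-- The algebraic core of (OM): affine in `g`, checked at the two endpoints. -/
lemma om_alg (m M r g yI yM yr : R) (hm : 0 ≤ m) (hM : 0 ≤ M) (hr : 0 ≤ r) (hg0 : 0 ≤ g)
    (hgr : g ≤ r) (hb : yI * r ≤ m * yr) (he : (yI + yM) * r ≤ (m + M) * yr) :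
    (r - g) * (m * (yI * (r - M) + yM * (m + r) - yr * (m + M))) ≤
      m * (m + M) * (yr * m - yI * r) := by
  have hRHS : 0 ≤ m * (m + M) * (yr * m - yI * r) :=
    mul_nonneg (mul_nonneg hm (add_nonneg hm hM)) (by linarith)
  have hzero : r * (m * (yI * (r - M) + yM * (m + r) - yr * (m + M))) ≤
      m * (m + M) * (yr * m - yI * r) := by
    have key : 0 ≤ m * (m + r) * ((m + M) * yr - (yI + yM) * r) :=
      mul_nonneg (mul_nonneg hm (add_nonneg hm hr)) (by linarith)
    nlinarith [key]
  by_cases hK : 0 ≤ m * (yI * (r - M) + yM * (m + r) - yr * (m + M))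
  · calc (r - g) * (m * (yI * (r - M) + yM * (m + r) - yr * (m + M)))
        ≤ r * (m * (yI * (r - M) + yM * (m + r) - yr * (m + M))) :=
          mul_le_mul_of_nonneg_right (by linarith) hK
      _ ≤ _ := hzero
  · have hK' := not_le.mp hK
    have : (r - g) * (m * (yI * (r - M) + yM * (m + r) - yr * (m + M))) ≤ 0 :=
      mul_nonpos_of_nonneg_of_nonpos (by linarith) hK'.le
    linarith

/-- The ideal term pays the pivotal mass times the product of the world shifts (mean form):
`pI ≤ p₀ ≤ p₁`, `qI ≤ q₁` and (OM) for `y` give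
`m (p₁ − pI)(q₁ − qI) ≥ P₀ (p₁ − p₀)(q₀ − q₁)`. -/
lemma ideal_term_alg (m P₀ p₁ pI p₀ q₁ qI q₀ : R) (hm : 0 ≤ m)
    (hpI : pI ≤ p₀) (hp : p₀ ≤ p₁) (hqI : qI ≤ q₁)
    (hOM : P₀ * (q₀ - q₁) ≤ m * (q₁ - qI)) :
    P₀ * (p₁ - p₀) * (q₀ - q₁) ≤ m * (p₁ - pI) * (q₁ - qI) := by
  have h1 : P₀ * (p₁ - p₀) * (q₀ - q₁) ≤ (p₁ - p₀) * (m * (q₁ - qI)) := by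
    have := mul_le_mul_of_nonneg_left hOM (by linarith : 0 ≤ p₁ - p₀)
    nlinarith [this]
  have h2 : (p₁ - p₀) * (m * (q₁ - qI)) ≤ m * (p₁ - pI) * (q₁ - qI) := by
    have hq' : 0 ≤ m * (q₁ - qI) := mul_nonneg hm (by linarith)
    nlinarith [mul_le_mul_of_nonneg_right (by linarith : p₁ - p₀ ≤ p₁ - pI) hq']
  linarith

end OneMarkerAlgebra

section OneMarkerChain

variable {V : Type*} [DecidableEq V] {R : Type*} [Field R] [LinearOrder R] [IsStrictOrderedRing R]

/-- The world-0 mean is below the mean of the tilted law `ν d` (`ν d` is Holley-above `ν c`):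
`(∑ ν c y)(∑ ν d) ≤ (∑ ν c)(∑ ν d y)`. -/
theorem mean_le_tilt (U : Finset V) (ν c d y : Finset V → R)
    (hν0 : ∀ W, 0 ≤ ν W) (hν : ∀ s ⊆ U, ∀ t ⊆ U, ν s * ν t ≤ ν (s ∩ t) * ν (s ∪ t))
    (hc0 : ∀ W, 0 ≤ c W) (hd0 : ∀ W, 0 ≤ d W)
    (hcd : ∀ s t, c s * d t ≤ c (s ∩ t) * d (s ∪ t))
    (hy0 : ∀ W, 0 ≤ y W) (hym : ∀ s t, y s ≤ y (s ∪ t)) :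
    (∑ W ∈ U.powerset, ν W * c W * y W) * (∑ W ∈ U.powerset, ν W * d W) ≤
      (∑ W ∈ U.powerset, ν W * c W) * (∑ W ∈ U.powerset, ν W * d W * y W) := by
  refine ad_pointwise U (fun W => ν W * c W * y W) (fun W => ν W * d W) (fun W => ν W * c W)
    (fun W => ν W * d W * y W) (fun W => mul_nonneg (mul_nonneg (hν0 W) (hc0 W)) (hy0 W))
    (fun W => mul_nonneg (hν0 W) (hd0 W)) (fun W => mul_nonneg (hν0 W) (hc0 W))
    (fun W => mul_nonneg (mul_nonneg (hν0 W) (hd0 W)) (hy0 W)) ?_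
  intro s hs t ht
  calc ν s * c s * y s * (ν t * d t) = (ν s * ν t) * (c s * d t) * y s := by ring
    _ ≤ (ν (s ∩ t) * ν (s ∪ t)) * (c (s ∩ t) * d (s ∪ t)) * y (s ∪ t) :=
        mul_le_mul (mul_le_mul (hν s hs t ht) (hcd s t) (mul_nonneg (hc0 _) (hd0 _))
          (mul_nonneg (hν0 _) (hν0 _))) (hym s t) (hy0 s)
          (mul_nonneg (mul_nonneg (hν0 _) (hν0 _)) (mul_nonneg (hc0 _) (hd0 _)))
    _ = ν (s ∩ t) * c (s ∩ t) * (ν (s ∪ t) * d (s ∪ t) * y (s ∪ t)) := by ring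

/-- The mean of the log-supermodular law `ν d` on the entered clusters (an up-set) is above its
global mean: `(∑ ν d y)(∑_D ν d) ≤ (∑ ν d)(∑_D ν d y)`. -/
theorem tilt_upset_mean (U ent' : Finset V) (ν d y : Finset V → R)
    (hν0 : ∀ W, 0 ≤ ν W) (hν : ∀ s ⊆ U, ∀ t ⊆ U, ν s * ν t ≤ ν (s ∩ t) * ν (s ∪ t))
    (hd0 : ∀ W, 0 ≤ d W) (hdd : ∀ s t, d s * d t ≤ d (s ∩ t) * d (s ∪ t))
    (hy0 : ∀ W, 0 ≤ y W) (hym : ∀ s t, y s ≤ y (s ∪ t)) :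
    (∑ W ∈ U.powerset, ν W * d W * y W) *
        (∑ W ∈ U.powerset.filter (fun W => ∃ r ∈ ent', r ∈ W), ν W * d W) ≤
      (∑ W ∈ U.powerset, ν W * d W) *
        (∑ W ∈ U.powerset.filter (fun W => ∃ r ∈ ent', r ∈ W), ν W * d W * y W) := by
  simp only [Finset.sum_filter]
  have n₂ : ∀ W, (0 : R) ≤ (if ∃ r ∈ ent', r ∈ W then ν W * d W else 0) := fun W => by
    split_ifs <;> [exact mul_nonneg (hν0 W) (hd0 W); exact le_rfl]
  have n₄ : ∀ W, (0 : R) ≤ (if ∃ r ∈ ent', r ∈ W then ν W * d W * y W else 0) := fun W => by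
    split_ifs <;> [exact mul_nonneg (mul_nonneg (hν0 W) (hd0 W)) (hy0 W); exact le_rfl]
  refine ad_pointwise U (fun W => ν W * d W * y W) _ (fun W => ν W * d W) _
    (fun W => mul_nonneg (mul_nonneg (hν0 W) (hd0 W)) (hy0 W)) n₂
    (fun W => mul_nonneg (hν0 W) (hd0 W)) n₄ ?_
  intro s hs t ht
  by_cases h : ∃ r ∈ ent', r ∈ t
  · have hu : ∃ r ∈ ent', r ∈ s ∪ t := by
      obtain ⟨r, hr, hrt⟩ := h; exact ⟨r, hr, Finset.mem_union_right _ hrt⟩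
    rw [if_pos h, if_pos hu]
    calc ν s * d s * y s * (ν t * d t) = (ν s * ν t) * (d s * d t) * y s := by ring
      _ ≤ (ν (s ∩ t) * ν (s ∪ t)) * (d (s ∩ t) * d (s ∪ t)) * y (s ∪ t) :=
          mul_le_mul (mul_le_mul (hν s hs t ht) (hdd s t) (mul_nonneg (hd0 _) (hd0 _))
            (mul_nonneg (hν0 _) (hν0 _))) (hym s t) (hy0 s)
            (mul_nonneg (mul_nonneg (hν0 _) (hν0 _)) (mul_nonneg (hd0 _) (hd0 _)))
      _ = ν (s ∩ t) * d (s ∩ t) * (ν (s ∪ t) * d (s ∪ t) * y (s ∪ t)) := by ring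
  · rw [if_neg h, mul_zero]
    exact mul_nonneg (mul_nonneg (hν0 _) (hd0 _)) (n₄ _)

/-- The ideal mean (world 0 on the entry-free clusters) is below the world-1 mean on the entered
clusters: `(∑_I ν c y)(∑_D ν d) ≤ (∑_I ν c)(∑_D ν d y)`. -/
theorem ideal_le_entered_R (U ent' : Finset V) (ν c d y : Finset V → R)
    (hν0 : ∀ W, 0 ≤ ν W) (hν : ∀ s ⊆ U, ∀ t ⊆ U, ν s * ν t ≤ ν (s ∩ t) * ν (s ∪ t))
    (hc0 : ∀ W, 0 ≤ c W) (hd0 : ∀ W, 0 ≤ d W)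
    (hcd : ∀ s t, c s * d t ≤ c (s ∩ t) * d (s ∪ t))
    (hy0 : ∀ W, 0 ≤ y W) (hym : ∀ s t, y s ≤ y (s ∪ t)) :
    (∑ W ∈ U.powerset.filter (fun W => ¬ ∃ r ∈ ent', r ∈ W), ν W * c W * y W) *
        (∑ W ∈ U.powerset.filter (fun W => ∃ r ∈ ent', r ∈ W), ν W * d W) ≤
      (∑ W ∈ U.powerset.filter (fun W => ¬ ∃ r ∈ ent', r ∈ W), ν W * c W) *
        (∑ W ∈ U.powerset.filter (fun W => ∃ r ∈ ent', r ∈ W), ν W * d W * y W) := by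
  simp only [Finset.sum_filter]
  have n₁ : ∀ W, (0 : R) ≤ (if ¬ ∃ r ∈ ent', r ∈ W then ν W * c W * y W else 0) := fun W => by
    split_ifs <;> first | exact le_rfl | exact mul_nonneg (mul_nonneg (hν0 W) (hc0 W)) (hy0 W)
  have n₂ : ∀ W, (0 : R) ≤ (if ∃ r ∈ ent', r ∈ W then ν W * d W else 0) := fun W => by
    split_ifs <;> [exact mul_nonneg (hν0 W) (hd0 W); exact le_rfl]
  have n₃ : ∀ W, (0 : R) ≤ (if ¬ ∃ r ∈ ent', r ∈ W then ν W * c W else 0) := fun W => by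
    split_ifs <;> first | exact le_rfl | exact mul_nonneg (hν0 W) (hc0 W)
  have n₄ : ∀ W, (0 : R) ≤ (if ∃ r ∈ ent', r ∈ W then ν W * d W * y W else 0) := fun W => by
    split_ifs <;> [exact mul_nonneg (mul_nonneg (hν0 W) (hd0 W)) (hy0 W); exact le_rfl]
  refine ad_pointwise U _ _ _ _ n₁ n₂ n₃ n₄ ?_
  intro s hs t ht
  by_cases hsI : ∃ r ∈ ent', r ∈ s
  · rw [if_neg (not_not.mpr hsI), zero_mul]; exact mul_nonneg (n₃ _) (n₄ _)
  · by_cases htD : ∃ r ∈ ent', r ∈ t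
    · have hiI : ¬ ∃ r ∈ ent', r ∈ s ∩ t := by
        rintro ⟨r, hr, hrst⟩; exact hsI ⟨r, hr, (Finset.mem_inter.1 hrst).1⟩
      have huD : ∃ r ∈ ent', r ∈ s ∪ t := by
        obtain ⟨r, hr, hrt⟩ := htD; exact ⟨r, hr, Finset.mem_union_right _ hrt⟩
      rw [if_pos hsI, if_pos htD, if_pos hiI, if_pos huD]
      calc ν s * c s * y s * (ν t * d t) = (ν s * ν t) * (c s * d t) * y s := by ring
        _ ≤ (ν (s ∩ t) * ν (s ∪ t)) * (c (s ∩ t) * d (s ∪ t)) * y (s ∪ t) :=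
            mul_le_mul (mul_le_mul (hν s hs t ht) (hcd s t) (mul_nonneg (hc0 _) (hd0 _))
              (mul_nonneg (hν0 _) (hν0 _))) (hym s t) (hy0 s)
              (mul_nonneg (mul_nonneg (hν0 _) (hν0 _)) (mul_nonneg (hc0 _) (hd0 _)))
        _ = ν (s ∩ t) * c (s ∩ t) * (ν (s ∪ t) * d (s ∪ t) * y (s ∪ t)) := by ring
    · rw [if_neg htD, mul_zero]; exact mul_nonneg (n₃ _) (n₄ _)

/-- The ideal mean is below the global world-0 mean: `(∑_I ν c y)(∑ ν c) ≤ (∑_I ν c)(∑ ν c y)`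
(`ideal_mean` in the entry-free form). -/
theorem ideal_le_global (U ent' : Finset V) (ν c y : Finset V → R)
    (hν0 : ∀ W, 0 ≤ ν W) (hν : ∀ s ⊆ U, ∀ t ⊆ U, ν s * ν t ≤ ν (s ∩ t) * ν (s ∪ t))
    (hc0 : ∀ W, 0 ≤ c W) (hcc : ∀ s t, c s * c t ≤ c (s ∩ t) * c (s ∪ t))
    (hy0 : ∀ W, 0 ≤ y W) (hym : ∀ s t, y s ≤ y (s ∪ t)) :
    (∑ W ∈ U.powerset.filter (fun W => ¬ ∃ r ∈ ent', r ∈ W), ν W * c W * y W) *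
        (∑ W ∈ U.powerset, ν W * c W) ≤
      (∑ W ∈ U.powerset.filter (fun W => ¬ ∃ r ∈ ent', r ∈ W), ν W * c W) *
        (∑ W ∈ U.powerset, ν W * c W * y W) := by
  simp only [Finset.sum_filter]
  have n₁ : ∀ W, (0 : R) ≤ (if ¬ ∃ r ∈ ent', r ∈ W then ν W * c W * y W else 0) := fun W => by
    split_ifs <;> first | exact le_rfl | exact mul_nonneg (mul_nonneg (hν0 W) (hc0 W)) (hy0 W)
  have n₃ : ∀ W, (0 : R) ≤ (if ¬ ∃ r ∈ ent', r ∈ W then ν W * c W else 0) := fun W => by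
    split_ifs <;> first | exact le_rfl | exact mul_nonneg (hν0 W) (hc0 W)
  refine ad_pointwise U _ (fun W => ν W * c W) _ (fun W => ν W * c W * y W) n₁
    (fun W => mul_nonneg (hν0 W) (hc0 W)) n₃
    (fun W => mul_nonneg (mul_nonneg (hν0 W) (hc0 W)) (hy0 W)) ?_
  intro s hs t ht
  by_cases hsI : ∃ r ∈ ent', r ∈ s
  · rw [if_neg (not_not.mpr hsI), zero_mul]
    exact mul_nonneg (n₃ _) (mul_nonneg (mul_nonneg (hν0 _) (hc0 _)) (hy0 _))
  · have hiI : ¬ ∃ r ∈ ent', r ∈ s ∩ t := by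
      rintro ⟨r, hr, hrst⟩; exact hsI ⟨r, hr, (Finset.mem_inter.1 hrst).1⟩
    rw [if_pos hsI, if_pos hiI]
    calc ν s * c s * y s * (ν t * c t) = (ν s * ν t) * (c s * c t) * y s := by ring
      _ ≤ (ν (s ∩ t) * ν (s ∪ t)) * (c (s ∩ t) * c (s ∪ t)) * y (s ∪ t) :=
          mul_le_mul (mul_le_mul (hν s hs t ht) (hcc s t) (mul_nonneg (hc0 _) (hc0 _))
            (mul_nonneg (hν0 _) (hν0 _))) (hym s t) (hy0 s)
            (mul_nonneg (mul_nonneg (hν0 _) (hν0 _)) (mul_nonneg (hc0 _) (hc0 _)))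
      _ = ν (s ∩ t) * c (s ∩ t) * (ν (s ∪ t) * c (s ∪ t) * y (s ∪ t)) := by ring

/-- **THE ONE-MARKER BOUND (OM), cleared form.** With `m, M, r, g, yI, yM, yr` the ideal and
entered masses of the world-0 law `ν c`, the world-1 `R`-law `ν d` and the world-1 gate `ν d'`
and the marker moments: `(r − g) m (yI (r − M) + yM (m + r) − yr (m + M)) ≤ m (m + M)(yr m − yI r)`,
i.e. `P₀ (q₀ − q₁) ≤ m (q₁ − qI)` after dividing by `m (m + M)(m + r)`. -/
theorem one_marker_bound (U ent' : Finset V) (ν c d d' y : Finset V → R)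
    (hν0 : ∀ W, 0 ≤ ν W) (hν : ∀ s ⊆ U, ∀ t ⊆ U, ν s * ν t ≤ ν (s ∩ t) * ν (s ∪ t))
    (hc0 : ∀ W, 0 ≤ c W) (hd0 : ∀ W, 0 ≤ d W) (hd'0 : ∀ W, 0 ≤ d' W) (hd'd : ∀ W, d' W ≤ d W)
    (hdd : ∀ s t, d s * d t ≤ d (s ∩ t) * d (s ∪ t))
    (hcd : ∀ s t, c s * d t ≤ c (s ∩ t) * d (s ∪ t))
    (hy0 : ∀ W, 0 ≤ y W) (hym : ∀ s t, y s ≤ y (s ∪ t)) :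
    ((∑ W ∈ U.powerset.filter (fun W => ∃ r ∈ ent', r ∈ W), ν W * d W) -
        (∑ W ∈ U.powerset.filter (fun W => ∃ r ∈ ent', r ∈ W), ν W * d' W)) *
      ((∑ W ∈ U.powerset.filter (fun W => ¬ ∃ r ∈ ent', r ∈ W), ν W * c W) *
        ((∑ W ∈ U.powerset.filter (fun W => ¬ ∃ r ∈ ent', r ∈ W), ν W * c W * y W) *
            ((∑ W ∈ U.powerset.filter (fun W => ∃ r ∈ ent', r ∈ W), ν W * d W) -
              (∑ W ∈ U.powerset.filter (fun W => ∃ r ∈ ent', r ∈ W), ν W * c W))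
          + (∑ W ∈ U.powerset.filter (fun W => ∃ r ∈ ent', r ∈ W), ν W * c W * y W) *
            ((∑ W ∈ U.powerset.filter (fun W => ¬ ∃ r ∈ ent', r ∈ W), ν W * c W) +
              (∑ W ∈ U.powerset.filter (fun W => ∃ r ∈ ent', r ∈ W), ν W * d W))
          - (∑ W ∈ U.powerset.filter (fun W => ∃ r ∈ ent', r ∈ W), ν W * d W * y W) *
            ((∑ W ∈ U.powerset.filter (fun W => ¬ ∃ r ∈ ent', r ∈ W), ν W * c W) +
              (∑ W ∈ U.powerset.filter (fun W => ∃ r ∈ ent', r ∈ W), ν W * c W)))) ≤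
    (∑ W ∈ U.powerset.filter (fun W => ¬ ∃ r ∈ ent', r ∈ W), ν W * c W) *
      ((∑ W ∈ U.powerset.filter (fun W => ¬ ∃ r ∈ ent', r ∈ W), ν W * c W) +
        (∑ W ∈ U.powerset.filter (fun W => ∃ r ∈ ent', r ∈ W), ν W * c W)) *
      ((∑ W ∈ U.powerset.filter (fun W => ∃ r ∈ ent', r ∈ W), ν W * d W * y W) *
          (∑ W ∈ U.powerset.filter (fun W => ¬ ∃ r ∈ ent', r ∈ W), ν W * c W)
        - (∑ W ∈ U.powerset.filter (fun W => ¬ ∃ r ∈ ent', r ∈ W), ν W * c W * y W) *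
          (∑ W ∈ U.powerset.filter (fun W => ∃ r ∈ ent', r ∈ W), ν W * d W)) := by
  set m := ∑ W ∈ U.powerset.filter (fun W => ¬ ∃ r ∈ ent', r ∈ W), ν W * c W with hm
  set M := ∑ W ∈ U.powerset.filter (fun W => ∃ r ∈ ent', r ∈ W), ν W * c W with hM
  set r := ∑ W ∈ U.powerset.filter (fun W => ∃ r ∈ ent', r ∈ W), ν W * d W with hr
  set g := ∑ W ∈ U.powerset.filter (fun W => ∃ r ∈ ent', r ∈ W), ν W * d' W with hg
  set yI := ∑ W ∈ U.powerset.filter (fun W => ¬ ∃ r ∈ ent', r ∈ W), ν W * c W * y W with hyI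
  set yM := ∑ W ∈ U.powerset.filter (fun W => ∃ r ∈ ent', r ∈ W), ν W * c W * y W with hyM
  set yr := ∑ W ∈ U.powerset.filter (fun W => ∃ r ∈ ent', r ∈ W), ν W * d W * y W with hyr
  have hm0 : 0 ≤ m := Finset.sum_nonneg fun W _ => mul_nonneg (hν0 W) (hc0 W)
  have hM0 : 0 ≤ M := Finset.sum_nonneg fun W _ => mul_nonneg (hν0 W) (hc0 W)
  have hr0 : 0 ≤ r := Finset.sum_nonneg fun W _ => mul_nonneg (hν0 W) (hd0 W)
  have hg0 : 0 ≤ g := Finset.sum_nonneg fun W _ => mul_nonneg (hν0 W) (hd'0 W)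
  have hgr : g ≤ r := Finset.sum_le_sum fun W _ => mul_le_mul_of_nonneg_left (hd'd W) (hν0 W)
  -- (b) the ideal mean is below the world-1 entered mean
  have hb : yI * r ≤ m * yr := ideal_le_entered_R U ent' ν c d y hν0 hν hc0 hd0 hcd hy0 hym
  -- (e) the world-0 mean is below the world-1 entered mean, through the global tilt `ν d`
  have he : (yI + yM) * r ≤ (m + M) * yr := by
    have hsplit : ∀ f : Finset V → R, (∑ W ∈ U.powerset, f W) =
        (∑ W ∈ U.powerset.filter (fun W => ¬ ∃ r ∈ ent', r ∈ W), f W) +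
          (∑ W ∈ U.powerset.filter (fun W => ∃ r ∈ ent', r ∈ W), f W) := by
      intro f
      rw [add_comm, Finset.sum_filter_add_sum_filter_not]
    have h1 := mean_le_tilt U ν c d y hν0 hν hc0 hd0 hcd hy0 hym
    have h2 := tilt_upset_mean U ent' ν d y hν0 hν hd0 hdd hy0 hym
    rw [hsplit (fun W => ν W * c W * y W), hsplit (fun W => ν W * c W)] at h1
    set D := ∑ W ∈ U.powerset, ν W * d W with hDdef
    set Dy := ∑ W ∈ U.powerset, ν W * d W * y W with hDydef
    have hD0 : 0 ≤ D := Finset.sum_nonneg fun W _ => mul_nonneg (hν0 W) (hd0 W)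
    -- h1 : (yI + yM) * D ≤ (m + M) * Dy ;  h2 : Dy * r ≤ D * yr
    have hchain : D * ((yI + yM) * r) ≤ D * ((m + M) * yr) := by
      have hmM : 0 ≤ m + M := add_nonneg hm0 hM0
      have e1 := mul_le_mul_of_nonneg_right h1 hr0
      have e2 := mul_le_mul_of_nonneg_left h2 hmM
      nlinarith [e1, e2]
    rcases eq_or_lt_of_le hD0 with hDz | hDpos
    · -- the tilted law vanishes: so do its entered mass and moment
      have hterm : ∀ W ∈ U.powerset, ν W * d W = 0 := by
        intro W hW
        have := (Finset.sum_eq_zero_iff_of_nonneg (fun W _ => mul_nonneg (hν0 W) (hd0 W))).1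
          hDz.symm W hW
        exact this
      have hr_zero : r = 0 := by
        rw [hr]
        exact Finset.sum_eq_zero fun W hW => hterm W (Finset.mem_filter.1 hW).1
      have hyr_zero : yr = 0 := by
        rw [hyr]
        exact Finset.sum_eq_zero fun W hW => by rw [hterm W (Finset.mem_filter.1 hW).1, zero_mul]
      rw [hr_zero, hyr_zero]; simp
    · exact le_of_mul_le_mul_left hchain hDpos
  have key := om_alg m M r g yI yM yr hm0 hM0 hr0 hg0 hgr hb he
  nlinarith [key]

end OneMarkerChain

end Summit.Ventures.PercRepro2.Coin
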